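import Summits.QuantumAdvantage.AdviceFreeQNC0.BShot
import Literature.Computability.AlgebraicComplexity.RazElusiveGeneralResultOne
import HarnessLib

/-!
# Cell qa-qnc0 (rung F-Q2-odd, `p = 3`): THEOREM A `bShotDWB3 : BShotDWB3` — the accounting

Planner qa-qnc0-p1 g16, `ROUND-15.md` §3.7 (formalisation map L7) for THEOREM A.  Parameters: `L = log₂ N`,
`B₀ = ⌊⌊√N⌋^{1/2}⌋` (`B⁴ ≤ N ⇒ B ≤ B₀`), `2^K ≥ 16/ε`, `A = c_A·B₀` with `c_A > 144·2^K/ε`, `ℓ = (A·Δ·L)²`,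
`W = (⌊K(6ℓ+1)/L⌋ + 4)·L`, `Q = ⌊n/W⌋` windows; the quiet window of `BShot.exists_window` is gauged.  All growth
conditions are `polylog(N)·B₀^j ≤ N` (`const_mul_logPow_le'`, `le_quartRoot_of_pow_four_le`).

* `growth_window` / `growth_budget` — the two integer budgets; `final_arith2` — the final real inequality;
* **`bShotDWB3 : BShotDWB3`**.

WHAT THIS IS NOT: the dense regime / `RingHardOdd 3`; separation NOT moved.
-/

noncomputable section

namespace Summit.QuantumAdvantage.AdviceFreeQNC0

namespace DWalk

open Finset Equiv
open Literature.Computability.MetaComplexity Literature.Computability.MetaComplexity.Smolensky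

/-- `x·B₀³ ≤ N` once `x ≤ B₀ = ⌊√⌊√N⌋⌋`. -/
theorem mul_cube_le {x N : ℕ} (hx : x ≤ Nat.sqrt (Nat.sqrt N)) :
    x * Nat.sqrt (Nat.sqrt N) ^ 3 ≤ N := by
  set B := Nat.sqrt (Nat.sqrt N) with hB
  have h1 : B * B ≤ Nat.sqrt N := Nat.sqrt_le (Nat.sqrt N)
  have h2 : Nat.sqrt N * Nat.sqrt N ≤ N := Nat.sqrt_le N
  calc x * B ^ 3 ≤ B * B ^ 3 := Nat.mul_le_mul_right _ hx
    _ = (B * B) * (B * B) := by ring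
    _ ≤ Nat.sqrt N * Nat.sqrt N := Nat.mul_le_mul h1 h1
    _ ≤ N := h2

/-- `x·B₀² ≤ N` once `x ≤ ⌊√N⌋`. -/
theorem mul_sq_le {x N : ℕ} (hx : x ≤ Nat.sqrt N) : x * Nat.sqrt (Nat.sqrt N) ^ 2 ≤ N := by
  have h1 : Nat.sqrt (Nat.sqrt N) * Nat.sqrt (Nat.sqrt N) ≤ Nat.sqrt N := Nat.sqrt_le (Nat.sqrt N)
  calc x * Nat.sqrt (Nat.sqrt N) ^ 2 ≤ Nat.sqrt N * Nat.sqrt N := by rw [pow_two]; exact Nat.mul_le_mul hx h1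
    _ ≤ N := Nat.sqrt_le N

/-- Budget for the fibre factor: `c·M ≤ N < 2·2^L`, `c ≥ 256/ε` give `M·(4/2^L) ≤ ε/32`. -/
theorem err_budget_le' {ε : ℝ} (hε : 0 < ε) {c L M N : ℕ} (hc : 256 / ε ≤ c) (hMN : c * M ≤ N)
    (hNL : (N : ℝ) < 2 * (2 : ℝ) ^ L) : (M : ℝ) * (4 / (2 : ℝ) ^ L) ≤ ε / 4 / 8 := by
  have h2L : (0 : ℝ) < (2 : ℝ) ^ L := by positivity
  have h1 : ((c * M : ℕ) : ℝ) ≤ N := by exact_mod_cast hMN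
  push_cast at h1
  have hM0 : (0 : ℝ) ≤ M := by positivity
  have hc' : 256 ≤ (c : ℝ) * ε := by rwa [div_le_iff₀ hε] at hc
  rw [mul_div_assoc', div_le_iff₀ h2L]
  nlinarith [mul_le_mul_of_nonneg_left h1 hε.le]

/-- The final real inequality. -/
theorem final_arith2 {ε ε' X P E T R : ℝ} (hε'0 : 0 < ε') (hε'1 : ε' ≤ 1) (hε'ε : ε' ≤ ε) (hT : 0 < T)
    (hE0 : 0 ≤ E) (hP : P ≤ 1 + ε' / 8) (hE : E ≤ 2 + ε' / 2) (hR : R ≤ ε' / 2 * T)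
    (hX : 3 * X ≤ T * P * E + R) : 3 * X ≤ 2 * T + ε * (2 * T) := by
  have h1 : P * E ≤ (1 + ε' / 8) * (2 + ε' / 2) := mul_le_mul hP hE hE0 (by linarith)
  have h2 : (1 + ε' / 8) * (2 + ε' / 2) ≤ 2 + 3 * ε' / 2 := by nlinarith
  have h3 : T * P * E ≤ T * (2 + 3 * ε' / 2) := by
    rw [mul_assoc]; exact mul_le_mul_of_nonneg_left (le_trans h1 h2) hT.le
  have h4 : ε' * T ≤ ε * T := mul_le_mul_of_nonneg_right hε'ε hT.le
  linarith only [hX, h3, hR, h4]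

/-- **THEOREM A `BShotDWB3` — PROVED** (ROUND-15 §3: window removal + gauge transport + structured law + Smolensky,
with the chargePair budget). -/
theorem bShotDWB3 : BShotDWB3 := by
  intro ε hε C
  obtain ⟨ε', hε'0, hε'1, hε'ε⟩ : ∃ ε' : ℝ, 0 < ε' ∧ ε' ≤ 1 ∧ ε' ≤ ε :=
    ⟨min ε 1, lt_min hε one_pos, min_le_right _ _, min_le_left _ _⟩
  obtain ⟨K, hK⟩ : ∃ K : ℕ, 16 / ε' ≤ (2 : ℝ) ^ K := by
    obtain ⟨K, hK⟩ := pow_unbounded_of_one_lt (16 / ε') (by norm_num : (1 : ℝ) < 2)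
    exact ⟨K, hK.le⟩
  obtain ⟨cA, hcA1, hcA⟩ : ∃ cA : ℕ, 1 ≤ cA ∧ 144 * (2 : ℝ) ^ K / ε' ≤ cA :=
    ⟨⌈144 * (2 : ℝ) ^ K / ε'⌉₊ + 1, by omega, le_trans (Nat.le_ceil _) (by push_cast; linarith)⟩
  obtain ⟨c12, hc12⟩ : ∃ c : ℕ, 12 / ε' ≤ c := ⟨_, Nat.le_ceil _⟩
  obtain ⟨c256, hc256⟩ : ∃ c : ℕ, 256 / ε' ≤ c := ⟨_, Nat.le_ceil _⟩
  -- integer budgets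
  obtain ⟨B₁, hB₁⟩ : ∃ B : ℕ, B = 7 * K * cA ^ 2 + 4 := ⟨_, rfl⟩
  obtain ⟨B₂, hB₂⟩ : ∃ B : ℕ, B = B₁ * (c12 + 1) := ⟨_, rfl⟩
  obtain ⟨N₁, hN₁⟩ := const_mul_logPow_le' (16 * B₂ ^ 4) (4 * (2 * C + 2))
  obtain ⟨N₂, hN₂⟩ := const_mul_logPow_le' ((c256 * B₁) ^ 2) (2 * (2 * C + 2))
  refine ⟨max (max N₁ N₂) 8, fun N hN w hw hshot4 => ?_⟩
  have hN1 : N₁ ≤ N := le_trans (le_trans (le_max_left _ _) (le_max_left _ _)) hN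
  have hN2 : N₂ ≤ N := le_trans (le_trans (le_max_right _ _) (le_max_left _ _)) hN
  have hN8 : 8 ≤ N := le_trans (le_max_right _ _) hN
  obtain ⟨n, rfl⟩ : ∃ n, N = n + 1 := ⟨N - 1, by omega⟩
  -- `B₀`, the sparsity bound
  obtain ⟨B₀, hB₀⟩ : ∃ B : ℕ, B = Nat.sqrt (Nat.sqrt (n + 1)) := ⟨_, rfl⟩
  have hB₀1 : 1 ≤ B₀ := by rw [hB₀, Nat.le_sqrt, Nat.le_sqrt]; omega
  have hshot : ∀ x : Fin (n + 1) → Bool, (univ.filter fun j : Fin (n + 1) => x j = false).card % 2 = 1 →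
      (univ.filter fun k : Fin (n + 1) => w k x = 1).card ≤ B₀ := fun x hx => by
    rw [hB₀]; exact Literature.Computability.AlgebraicComplexity.le_quartRoot_of_pow_four_le (hshot4 x hx)
  -- parameters
  obtain ⟨L, hLdef⟩ : ∃ L : ℕ, L = Nat.log 2 (n + 1) := ⟨_, rfl⟩
  have hL3 : 3 ≤ L := by rw [hLdef]; exact Nat.le_log_of_pow_le (by norm_num) hN8
  obtain ⟨A, hA⟩ : ∃ A : ℕ, A = cA * B₀ := ⟨_, rfl⟩
  have hA1 : 1 ≤ A := by rw [hA]; exact Nat.mul_le_mul hcA1 hB₀1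
  have hbud := window_budget K A L C hL3 hA1
  obtain ⟨ℓ, hℓdef⟩ : ∃ ℓ : ℕ, ℓ = (A * L ^ C * L) ^ 2 := ⟨_, rfl⟩
  obtain ⟨m, hmdef⟩ : ∃ m : ℕ, m = K * (6 * ℓ + 1) / L + 3 := ⟨_, rfl⟩
  rw [← hℓdef, ← hmdef] at hbud
  obtain ⟨hbud1, hbud2⟩ := hbud
  have hL1 : 1 ≤ L := by omega
  have hΔL : 1 ≤ L ^ C * L := Nat.mul_le_mul (Nat.one_le_pow _ _ hL1) hL1
  have hℓ1 : 1 ≤ ℓ := by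
    rw [hℓdef]; refine Nat.one_le_pow _ _ ?_
    have : 1 ≤ A * (L ^ C * L) := Nat.mul_le_mul hA1 hΔL
    rw [Nat.mul_assoc]; exact this
  obtain ⟨Lf, hLfdef⟩ : ∃ Lf : ℕ, Lf = (m + 1) * L - K * (6 * ℓ + 1) := ⟨_, rfl⟩
  have hLf3 : 3 ≤ Lf := by omega
  have hW : (m + 1) * L = K * (6 * ℓ + 1) + Lf := by omega
  obtain ⟨W, hWdef⟩ : ∃ W : ℕ, W = (m + 1) * L := ⟨_, rfl⟩
  rw [← hWdef] at hbud1 hbud2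
  -- `W ≤ B₁·B₀²·L^{2C+2}`
  have hB₀sq : 1 ≤ B₀ ^ 2 := Nat.one_le_pow _ _ hB₀1
  have hWle : W ≤ B₁ * B₀ ^ 2 * L ^ (2 * C + 2) := by
    have h1 : 7 * K * A ^ 2 + 4 ≤ B₁ * B₀ ^ 2 := by
      rw [hB₁, hA, Nat.add_mul]
      have : 7 * K * (cA * B₀) ^ 2 = 7 * K * cA ^ 2 * B₀ ^ 2 := by ring
      rw [this]
      exact Nat.add_le_add_left (le_trans (by norm_num) (Nat.mul_le_mul_left 4 hB₀sq)) _
    exact le_trans hbud2 (Nat.mul_le_mul_right _ h1)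
  -- (G2) windows: `Q ≥ c12·B₀ + 1` and `Q·W ≤ n`
  have hWpos : 0 < W := by omega
  have hG2 : W * (c12 * B₀ + 1) ≤ n := by
    have h := hN₁ (n + 1) hN1
    rw [← hLdef] at h
    -- `2·B₂·L^d ≤ B₀` from `(2 B₂ L^d)^4 ≤ N`
    have hx : 2 * B₂ * L ^ (2 * C + 2) ≤ B₀ := by
      rw [hB₀]; apply Literature.Computability.AlgebraicComplexity.le_quartRoot_of_pow_four_le
      calc (2 * B₂ * L ^ (2 * C + 2)) ^ 4 = 16 * B₂ ^ 4 * L ^ (4 * (2 * C + 2)) := by ring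
        _ ≤ n + 1 := h
    have h2 : 2 * B₂ * L ^ (2 * C + 2) * B₀ ^ 3 ≤ n + 1 := by
      have hx' := hx
      rw [hB₀] at hx'
      have := mul_cube_le hx'
      rwa [← hB₀] at this
    have h3 : W * (c12 * B₀ + 1) ≤ B₂ * L ^ (2 * C + 2) * B₀ ^ 3 := by
      have h4 : c12 * B₀ + 1 ≤ (c12 + 1) * B₀ := by rw [Nat.add_mul, one_mul]; omega
      calc W * (c12 * B₀ + 1) ≤ (B₁ * B₀ ^ 2 * L ^ (2 * C + 2)) * ((c12 + 1) * B₀) := Nat.mul_le_mul hWle h4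
        _ = B₂ * L ^ (2 * C + 2) * B₀ ^ 3 := by rw [hB₂]; ring
    have h5 : 2 * (B₂ * L ^ (2 * C + 2) * B₀ ^ 3) ≤ n + 1 := by
      have e : 2 * (B₂ * L ^ (2 * C + 2) * B₀ ^ 3) = 2 * B₂ * L ^ (2 * C + 2) * B₀ ^ 3 := by ring
      rw [e]; exact h2
    omega
  obtain ⟨Q, hQdef⟩ : ∃ Q : ℕ, Q = n / W := ⟨_, rfl⟩
  have hQge : c12 * B₀ + 1 ≤ Q := by
    rw [hQdef, Nat.le_div_iff_mul_le hWpos, Nat.mul_comm]; exact hG2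
  have hQ1 : 1 ≤ Q := le_trans (by omega) hQge
  have hQW : Q * W ≤ n := by rw [hQdef]; exact Nat.div_mul_le_self n W
  -- (G3) `c256·(m+1) ≤ N`
  have hG3 : c256 * (m + 1) ≤ n + 1 := by
    have h := hN₂ (n + 1) hN2
    rw [← hLdef] at h
    have hx : c256 * B₁ * L ^ (2 * C + 2) ≤ Nat.sqrt (n + 1) := by
      rw [Nat.le_sqrt]
      calc c256 * B₁ * L ^ (2 * C + 2) * (c256 * B₁ * L ^ (2 * C + 2))
          = (c256 * B₁) ^ 2 * L ^ (2 * (2 * C + 2)) := by ring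
        _ ≤ n + 1 := h
    have h2 := mul_sq_le hx
    rw [← hB₀] at h2
    have hmW : m + 1 ≤ W := by rw [hWdef]; exact Nat.le_mul_of_pos_right _ (by omega)
    calc c256 * (m + 1) ≤ c256 * (B₁ * B₀ ^ 2 * L ^ (2 * C + 2)) := Nat.mul_le_mul_left _ (le_trans hmW hWle)
      _ = c256 * B₁ * L ^ (2 * C + 2) * B₀ ^ 2 := by ring
      _ ≤ n + 1 := h2
  -- the quiet window
  obtain ⟨i, hiQ, hcnt⟩ := exists_window (W := W) hQ1 w hshot
  obtain ⟨a, ha⟩ : ∃ a : ℕ, a = i * W := ⟨_, rfl⟩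
  rw [← ha] at hcnt
  have haW : a + (m + 1) * L ≤ n := by
    have : (i + 1) * W ≤ Q * W := Nat.mul_le_mul_right _ hiQ
    rw [Nat.add_mul, one_mul] at this; rw [ha, ← hWdef]; omega
  have haWW : a + W = a + (m + 1) * L := by rw [hWdef]
  -- main count for the trimmed bells
  have hw' : ∀ k, w k ∈ lowDeg (ZMod 3) (n + 1) (L ^ C) := by rw [hLdef]; exact hw
  have hmain := card_win_wtil_le haW hL3 hℓ1 hLf3 hW (Δ := L ^ C) hw' hshot
  have hrem := card_win_le_wtil (a := a) (L := L) (m := m) w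
  -- error terms
  have h2K : (0 : ℝ) < (2 : ℝ) ^ K := by positivity
  have hE1 : 4 / (2 : ℝ) ^ K ≤ ε' / 4 := by
    rw [div_le_iff₀ h2K]
    have : 16 ≤ ε' * (2 : ℝ) ^ K := by rwa [div_le_iff₀ hε'0, mul_comm] at hK
    linarith only [this]
  have hE2 : 18 * (2 : ℝ) ^ K * ((B₀ * (2 * (L ^ C * L)) : ℕ) : ℝ) / Real.sqrt ℓ ≤ ε' / 4 := by
    have hB₀r : (1 : ℝ) ≤ B₀ := by exact_mod_cast hB₀1
    have hDL : (1 : ℝ) ≤ ((L ^ C * L : ℕ) : ℝ) := by exact_mod_cast hΔL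
    have hsq : Real.sqrt (ℓ : ℝ) = (cA : ℝ) * B₀ * ((L ^ C * L : ℕ) : ℝ) := by
      rw [hℓdef, hA]; push_cast
      rw [show ((cA : ℝ) * B₀ * (L : ℝ) ^ C * L) ^ 2 = ((cA : ℝ) * B₀ * ((L : ℝ) ^ C * L)) ^ 2 by ring]
      exact Real.sqrt_sq (by positivity)
    rw [hsq, div_le_iff₀ (by positivity)]
    push_cast
    have hcA' : 144 * (2 : ℝ) ^ K ≤ (cA : ℝ) * ε' := (div_le_iff₀ hε'0).1 hcA
    have hY0 : (0 : ℝ) ≤ (B₀ : ℝ) * ((L : ℝ) ^ C * L) := by positivity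
    have h5 := mul_le_mul_of_nonneg_right hcA' hY0
    linarith only [h5]
  have hE : 2 + 4 / (2 : ℝ) ^ K + 18 * (2 : ℝ) ^ K * ((B₀ * (2 * (L ^ C * L)) : ℕ) : ℝ) / Real.sqrt ℓ ≤
      2 + ε' / 2 := by linarith only [hE1, hE2]
  have hNL : ((n + 1 : ℕ) : ℝ) < 2 * (2 : ℝ) ^ L := by
    have h := Nat.lt_pow_succ_log_self (b := 2) one_lt_two (n + 1)
    rw [← hLdef, pow_succ] at h
    have h' : ((n + 1 : ℕ) : ℝ) < ((2 ^ L * 2 : ℕ) : ℝ) := by exact_mod_cast h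
    have h'' : ((2 ^ L * 2 : ℕ) : ℝ) = 2 * (2 : ℝ) ^ L := by push_cast; ring
    linarith only [h', h'']
  have hMx : ((m + 1 : ℕ) : ℝ) * (4 / (2 : ℝ) ^ L) ≤ ε' / 4 / 8 := err_budget_le' hε'0 hc256 hG3 hNL
  have hR3' : (1 + 4 / (2 : ℝ) ^ L) ^ (m + 1) ≤ 1 + ε' / 4 / 2 :=
    err_pow_le (ε := ε' / 4) (L := L) (M := m + 1) (by linarith) hMx
  have hR3 : (1 + 4 / (2 : ℝ) ^ L) ^ (m + 1) ≤ 1 + ε' / 8 := le_trans hR3' (le_of_eq (by ring))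
  -- window-removal term: `3·cnt ≤ (ε'/2)·2^n`
  obtain ⟨cnt, hcntdef⟩ : ∃ cnt : ℕ, cnt = (univ.filter fun x : Fin (n + 1) → Bool =>
      (univ.filter fun j : Fin (n + 1) => x j = false).card % 2 = 1 ∧
        ∃ k : Fin (n + 1), (a < k.val ∧ k.val < a + W) ∧ w k x = 1).card := ⟨_, rfl⟩
  rw [← hcntdef] at hcnt
  have hRterm : 3 * (cnt : ℝ) ≤ ε' / 2 * (2 : ℝ) ^ n := by
    have hc : (Q : ℝ) * cnt ≤ (B₀ : ℝ) * (2 * (2 : ℝ) ^ n) := by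
      have h1 : ((Q * cnt : ℕ) : ℝ) ≤ ((B₀ * 2 ^ (n + 1) : ℕ) : ℝ) := by exact_mod_cast hcnt
      push_cast at h1; rw [pow_succ] at h1; linarith only [h1]
    have hB : (0 : ℝ) ≤ B₀ := by positivity
    have hQr : 12 * (B₀ : ℝ) ≤ ε' * Q := by
      have h1 : ((c12 * B₀ + 1 : ℕ) : ℝ) ≤ Q := by exact_mod_cast hQge
      push_cast at h1
      have h2 : 12 ≤ (c12 : ℝ) * ε' := by rwa [div_le_iff₀ hε'0] at hc12
      have h3 := mul_le_mul_of_nonneg_right h2 hB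
      have h4 := mul_le_mul_of_nonneg_left h1 hε'0.le
      linarith only [h3, h4, hε'0]
    have hcnt0 : (0 : ℝ) ≤ cnt := by positivity
    have hB₀r : (1 : ℝ) ≤ B₀ := by exact_mod_cast hB₀1
    have h5 := mul_le_mul_of_nonneg_right hQr hcnt0
    have h6 := mul_le_mul_of_nonneg_left hc hε'0.le
    have h7 : (B₀ : ℝ) * (12 * cnt) ≤ (B₀ : ℝ) * (2 * ε' * (2 : ℝ) ^ n) := by linarith only [h5, h6]
    have h8 := le_of_mul_le_mul_left h7 (by linarith only [hB₀r])
    linarith only [h8]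
  -- assemble
  have hrem' : ((univ.filter fun x : Fin (n + 1) → Bool =>
      (univ.filter fun j : Fin (n + 1) => x j = false).card % 2 = 1 ∧ WinOdd w x).card : ℝ) ≤
      ((univ.filter fun x : Fin (n + 1) → Bool =>
        (univ.filter fun j : Fin (n + 1) => x j = false).card % 2 = 1 ∧ WinOdd (wtil a L m w) x).card : ℝ) +
      cnt := by
    have h' := hrem
    unfold Inner at h'; rw [← haWW, ← hcntdef] at h'
    exact_mod_cast h'
  have hX : 3 * ((univ.filter fun x : Fin (n + 1) → Bool =>
      (univ.filter fun j : Fin (n + 1) => x j = false).card % 2 = 1 ∧ WinOdd w x).card : ℝ) ≤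
      (2 : ℝ) ^ n * (1 + 4 / (2 : ℝ) ^ L) ^ (m + 1) *
        (2 + 4 / (2 : ℝ) ^ K + 18 * (2 : ℝ) ^ K * ((B₀ * (2 * (L ^ C * L)) : ℕ) : ℝ) / Real.sqrt ℓ) +
      3 * (cnt : ℝ) := by linarith only [hmain, hrem']
  simp only [WinOdd] at hX
  have hpow : (2 : ℝ) ^ (n + 1) = 2 * (2 : ℝ) ^ n := by ring
  rw [hpow]
  exact final_arith2 hε'0 hε'1 hε'ε (by positivity) (by positivity) hR3 hE hRterm hX

end DWalk

end Summit.QuantumAdvantage.AdviceFreeQNC0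

end
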